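import Literature.NumberTheory.DiophantineGeometry.CatalanThaine
import HarnessLib

/-!
# Thaine's theorem for `ℚ(ζ_p)`, V: Theorem 16.3 from the auxiliary primes [Schoof2009, §16]

This file packages [Schoof2009, Theorem 16.3] (`CatalanThaine.thaine_aux`, Thaine's theorem for a
given auxiliary prime) into its final class-group-free form, leaving exactly the output of
[Schoof2009, Lemma 16.2] (the existence of the auxiliary primes: class field theory, Kummer theory
and Chebotarev's density theorem) as the hypothesis `hAux`:

* `Catalan.Thaine.Rep.congr_base` — `Rep` only depends on `s` modulo `l`;
* `Catalan.Thaine.thaine_core` — `thaine_aux` with the auxiliary field `L = K(ζ_l)` instantiated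
  (`CyclotomicField l K`) and the generator `τ` replaced by a primitive root `s` modulo `l`;
* `Catalan.Thaine.exists_rep_eplus` — the index-vector hypothesis of `thaine_core` ("some `u₀^y`
  has index vector `½(δ_1 + δ_ι)` for the primitive root `s`") follows, for a suitable primitive
  root `s`, from: **`u₀` is not a `q`-th power modulo `𝔩`, and is a `q`-th power modulo `σ_b(𝔩)`
  for `b ≠ ±1`** (the third property of [Schoof2009, Lemma 16.2] for the generator `u₀`);
* `Catalan.Thaine.AnnIdeal`, `thaine` — **[Schoof2009, Theorem 16.3]**: if `θ = ∑ t_b σ_b`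
  (symmetric) satisfies `u₀^θ w^q = γ v^q` and every non-zero ideal `𝔠` of `𝓞 K` admits an
  auxiliary prime `𝔩` as in Lemma 16.2 (`hAux`: `l ≡ 1 (mod pq)`, `𝔩 ∣ l`, `[𝔩] = [𝔠]` modulo
  principal ideals and `q`-th powers, and the `q`-th power residue conditions on `u₀`), then for
  every `𝔠` the ideal `∏_b σ_b(𝔠 · ι𝔠)^{t_b}` is principal times a `q`-th power: *`θ` annihilates
  `Cl⁺/Cl⁺^q`* (every `ι`-invariant class modulo `q` is of the form `[𝔠 · ι𝔠]`, `q` odd).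

Everything is proved; the definitions are `QRel`, `AnnIdeal` and the target vector `eplus`.

## References

* R. Schoof, *Catalan's Conjecture*, Universitext, Springer 2009 [Schoof2009], Lemma 16.2,
  Theorem 16.3 (book pp. 109–113) — held, `lit read book:schoof2009-catalan-s-conjecture`
  (PDF pp. 183–188).
* L. C. Washington, *Introduction to Cyclotomic Fields*, GTM 83, Springer 1997 [Washington1997],
  §15.2 (Thaine's theorem).
-/

namespace Literature.NumberTheory.DiophantineGeometry

namespace Catalan.Thaine

open NumberField Finset Ideal IsCyclotomicExtension
open Literature.NumberTheory.NumberFields.Stickelberger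
open scoped Pointwise

variable {p : ℕ} [hp : Fact p.Prime] {K : Type} [Field K] [NumberField K]
  [hK : IsCyclotomicExtension {p} ℚ K]
variable {l : ℕ} [hl : Fact l.Prime]
variable (𝔩 : Ideal (𝓞 K)) [h𝔩m : 𝔩.IsMaximal] [h𝔩l : 𝔩.LiesOver (Ideal.span {(l : ℤ)})]

/-! ### `Rep` only depends on `s mod l` -/

omit hl h𝔩m in
include h𝔩l in
/-- congruent bases give the same index vectors. [folklore] -/
theorem Rep.congr_base {s s' q : ℕ} (hss' : (l : ℤ) ∣ (s : ℤ) - s') {x : 𝓞 K} {k : (ZMod p)ˣ → ℕ}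
    (h : Rep 𝔩 s q x k) : Rep 𝔩 s' q x k := by
  intro b
  obtain ⟨z, hz, hx⟩ := h b
  refine ⟨z, hz, ?_⟩
  obtain ⟨m, hm⟩ := hss'
  have hd : (s : 𝓞 K) - (s' : 𝓞 K) ∈ gal p K b • 𝔩 := by
    have e : (s : 𝓞 K) - (s' : 𝓞 K) = ((l : ℤ) : 𝓞 K) * (m : 𝓞 K) := by
      have := congrArg (fun z : ℤ => (z : 𝓞 K)) hm
      push_cast at this ⊢
      exact this
    rw [e]
    exact Ideal.mul_mem_right _ _ (natCast_mem_smul (l := l) 𝔩 b)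
  obtain ⟨c, hc⟩ := sub_dvd_pow_sub_pow (s : 𝓞 K) (s' : 𝓞 K) (k b)
  have e : x - (s' : 𝓞 K) ^ k b * z ^ q = (x - (s : 𝓞 K) ^ k b * z ^ q) +
      ((s : 𝓞 K) ^ k b - (s' : 𝓞 K) ^ k b) * z ^ q := by ring
  rw [e, hc]
  exact Ideal.add_mem _ hx (Ideal.mul_mem_right _ _ (Ideal.mul_mem_right _ _ hd))

/-! ### Theorem 16.3 for the auxiliary prime, with `L = K(ζ_l)` instantiated -/

include hK h𝔩m h𝔩l in
/-- **[Schoof2009, Theorem 16.3] for a given auxiliary prime** (`thaine_aux` with the auxiliary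
field `K(ζ_l)` supplied and the generator of its Galois group replaced by a primitive root `s`
modulo `l`): for `θ = ∑ t_b σ_b` symmetric with `u₀^θ w^q = γ v^q` (`γ` a cyclotomic unit, `v, w`
prime to `l`), `l ≡ 1 (mod p)`, `q ∣ l - 1`, `𝔩 ∣ l`, and `u₀^y` with index vector `½(δ_1 + δ_ι)`
with respect to the primitive root `s`, the ideal `∏_b σ_b(𝔩)^{t_b}` is principal times a `q`-th
power. [cite: Schoof2009, Theorem 16.3 (proof, pp. 109–110)] [cite: Washington1997, Thm. 15.2] -/
theorem thaine_core (hp2 : p ≠ 2) {q : ℕ} [NeZero q] (hq : Odd q) (hpl : p ≠ l) (hl1 : p ∣ l - 1)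
    (hlq : q ∣ l - 1) {s : ℕ} (hs : orderOf ((s : ℕ) : ZMod l) = l - 1)
    {ζ : K} (hζ : IsPrimitiveRoot ζ p) {t : (ZMod p)ˣ → ℕ} (ht : ∀ b, t (-b) = t b)
    {u₀ v w : 𝓞 K} (hv : ∀ b, v ∉ gal p K b • 𝔩) (hw : ∀ b, w ∉ gal p K b • 𝔩)
    {e₀ e₁ : ℕ} {n : (ZMod p)ˣ → ℕ} (H : galPow t u₀ * w ^ q = cycElt hζ e₀ e₁ n * v ^ q)
    {y e : (ZMod p)ˣ → ℕ} (hy : Rep 𝔩 s q (galPow y u₀) e)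
    (he : ∀ c, (e c : ZMod q) = if c = 1 ∨ c = -1 then (((q + 1) / 2 : ℕ) : ZMod q) else 0) :
    Ann 𝔩 q (fun b : (ZMod p)ˣ => (t b : ZMod q)) := by
  haveI : NeZero l := ⟨hl.out.ne_zero⟩
  have hl' := hl.out
  -- the auxiliary field
  let L := CyclotomicField l K
  haveI : NumberField L := numberField (K := K) (l := l) L
  -- `s` is a unit of `ZMod l` of order `l - 1`
  have hs0 : ((s : ℕ) : ZMod l) ≠ 0 := by
    intro h0
    rw [h0, orderOf_zero] at hs
    have := hl'.two_le
    omega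
  set u : (ZMod l)ˣ := Units.mk0 _ hs0 with hu
  have hord : orderOf u = l - 1 := by
    rw [← orderOf_injective (Units.coeHom (ZMod l)) Units.coeHom_injective u]
    exact hs
  -- the generator `τ` with `galEquiv τ = u`
  set τ : Gal(L/K) := (galEquiv L hpl).symm u with hτ
  have hτu : galEquiv L hpl τ = u := by rw [hτ, MulEquiv.apply_symm_apply]
  have hgen : ∀ x : Gal(L/K), x ∈ Subgroup.zpowers τ := by
    have htop : Subgroup.zpowers τ = ⊤ := by
      apply Subgroup.eq_top_of_card_eq
      rw [Nat.card_zpowers, card_gal L hpl,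
        ← orderOf_injective (galEquiv L hpl).toMonoidHom (galEquiv L hpl).injective τ]
      show orderOf (galEquiv L hpl τ) = l - 1
      rw [hτu, hord]
    intro x
    rw [htop]; exact Subgroup.mem_top x
  -- `(galEquiv τ).val ≡ s (mod l)`
  have hval : (((galEquiv L hpl τ : (ZMod l)ˣ) : ZMod l).val : ℤ) = (s : ℤ) % l := by
    rw [hτu, hu, Units.val_mk0, ZMod.val_natCast, Int.natCast_mod]
  have hy' : Rep 𝔩 ((galEquiv L hpl τ : (ZMod l)ˣ) : ZMod l).val q (galPow y u₀) e := by
    refine Rep.congr_base (l := l) 𝔩 ?_ hy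
    rw [hval]
    exact ⟨(s : ℤ) / l, by rw [Int.emod_def]; ring⟩
  exact thaine_aux (K := K) L 𝔩 hp2 hq hpl hl1 hlq hgen hζ ht hv hw H hy' he

/-! ### Ideals modulo principal ideals and `q`-th powers -/

section Ideals

variable {𝔩}

/-- **`QRel q I I'`: `I ≡ I'` modulo principal ideals and `q`-th powers of ideals** (equality of
the classes in `Cl_K/Cl_K^q`, stated without the class group). [folklore] -/
def QRel (q : ℕ) (I I' : Ideal (𝓞 K)) : Prop :=
  ∃ (γ₁ γ₂ : 𝓞 K) (M₁ M₂ : Ideal (𝓞 K)), γ₁ ≠ 0 ∧ γ₂ ≠ 0 ∧ M₁ ≠ ⊥ ∧ M₂ ≠ ⊥ ∧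
    Ideal.span {γ₁} * M₁ ^ q * I = Ideal.span {γ₂} * M₂ ^ q * I'

/-- **`AnnIdeal q I t`: `∏_b σ_b(I)^{t_b}` is principal modulo `q`-th powers** (`θ = ∑ t_b σ_b` kills
the class of `I` in `Cl_K/Cl_K^q`). [cite: Schoof2009, Theorem 16.3] -/
def AnnIdeal (q : ℕ) (I : Ideal (𝓞 K)) (t : (ZMod p)ˣ → ℕ) : Prop :=
  ∃ (β₁ β₂ : 𝓞 K) (J₁ J₂ : Ideal (𝓞 K)), β₁ ≠ 0 ∧ β₂ ≠ 0 ∧ J₁ ≠ ⊥ ∧ J₂ ≠ ⊥ ∧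
    Ideal.span {β₁} * J₁ ^ q * ∏ b, (gal p K b • I) ^ t b = Ideal.span {β₂} * J₂ ^ q

omit hl in
/-- `σ_a` of a principal ideal. [folklore] -/
theorem smul_span_singleton (a : (ZMod p)ˣ) (β : 𝓞 K) :
    gal p K a • (Ideal.span {β} : Ideal (𝓞 K)) = Ideal.span {gal p K a • β} := by
  rw [Ideal.pointwise_smul_def, Ideal.map_span, Set.image_singleton]
  rfl

omit hl in
/-- `σ_a β ≠ 0` for `β ≠ 0`. [folklore] -/
theorem smul_ne_zero' (a : (ZMod p)ˣ) {β : 𝓞 K} (hβ : β ≠ 0) : gal p K a • β ≠ 0 := fun h0 =>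
  hβ (by have := congrArg (fun x => (gal p K a)⁻¹ • x) h0; simpa using this)

omit hl in
/-- `QRel` is preserved by `σ_a`. [folklore] -/
theorem QRel.smul {q : ℕ} {I I' : Ideal (𝓞 K)} (h : QRel q I I') (a : (ZMod p)ˣ) :
    QRel q (gal p K a • I) (gal p K a • I') := by
  obtain ⟨γ₁, γ₂, M₁, M₂, h₁, h₂, hM₁, hM₂, h⟩ := h
  refine ⟨gal p K a • γ₁, gal p K a • γ₂, gal p K a • M₁, gal p K a • M₂, smul_ne_zero' a h₁,
    smul_ne_zero' a h₂, gal_smul_ne_bot a hM₁, gal_smul_ne_bot a hM₂, ?_⟩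
  have e := congrArg (fun J : Ideal (𝓞 K) => gal p K a • J) h
  simpa only [smul_mul', smul_pow', smul_span_singleton] using e

omit [NumberField K] hl in
/-- `QRel` is multiplicative. [folklore] -/
theorem QRel.mul {q : ℕ} {I I' J J' : Ideal (𝓞 K)} (h : QRel q I I') (h' : QRel q J J') :
    QRel q (I * J) (I' * J') := by
  obtain ⟨γ₁, γ₂, M₁, M₂, h₁, h₂, hM₁, hM₂, h⟩ := h
  obtain ⟨δ₁, δ₂, N₁, N₂, k₁, k₂, hN₁, hN₂, k⟩ := h'
  refine ⟨γ₁ * δ₁, γ₂ * δ₂, M₁ * N₁, M₂ * N₂, mul_ne_zero h₁ k₁, mul_ne_zero h₂ k₂,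
    mul_ne_bot' hM₁ hN₁, mul_ne_bot' hM₂ hN₂, ?_⟩
  have e := congrArg₂ (· * ·) h k
  rw [← Ideal.span_singleton_mul_span_singleton, ← Ideal.span_singleton_mul_span_singleton]
  calc _ = (Ideal.span {γ₁} * M₁ ^ q * I) * (Ideal.span {δ₁} * N₁ ^ q * J) := by ring
    _ = _ := e
    _ = _ := by ring

omit hl in
/-- `∏_b σ_b(β)^{t_b}`-type products of principal ideals are principal. [folklore] -/
theorem prod_smul_span_pow (t : (ZMod p)ˣ → ℕ) (β : 𝓞 K) :
    ∏ b, (gal p K b • (Ideal.span {β} : Ideal (𝓞 K))) ^ t b = Ideal.span {galPow t β} := by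
  unfold galPow
  rw [← Ideal.prod_span_singleton]
  refine Finset.prod_congr rfl fun b _ => ?_
  rw [smul_span_singleton, Ideal.span_singleton_pow]

omit hl in
/-- **`AnnIdeal` only depends on the class modulo principal ideals and `q`-th powers.** [folklore] -/
theorem AnnIdeal.congr {q : ℕ} {I I' : Ideal (𝓞 K)} {t : (ZMod p)ˣ → ℕ} (hII' : QRel q I I')
    (h : AnnIdeal q I t) : AnnIdeal q I' t := by
  obtain ⟨γ₁, γ₂, M₁, M₂, h₁, h₂, hM₁, hM₂, hrel⟩ := hII'
  obtain ⟨β₁, β₂, J₁, J₂, k₁, k₂, hJ₁, hJ₂, h⟩ := h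
  -- apply `σ_b` and raise to `t_b`, multiply over `b`
  have e : ∀ b, (gal p K b • Ideal.span {γ₁}) ^ t b * ((gal p K b • M₁) ^ t b) ^ q * (gal p K b • I) ^ t b =
      (gal p K b • Ideal.span {γ₂}) ^ t b * ((gal p K b • M₂) ^ t b) ^ q * (gal p K b • I') ^ t b := by
    intro b
    have := congrArg (fun J : Ideal (𝓞 K) => (gal p K b • J) ^ t b) hrel
    simp only [smul_mul', smul_pow', mul_pow] at this
    rw [← pow_mul, ← pow_mul, mul_comm q] at this
    rw [← pow_mul, ← pow_mul]
    exact this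
  have e2 := Finset.prod_congr rfl fun b (_ : b ∈ Finset.univ) => e b
  simp only [Finset.prod_mul_distrib, Finset.prod_pow, prod_smul_span_pow] at e2
  -- combine with `h`
  have hg₁ : galPow t γ₁ ≠ 0 := by
    unfold galPow
    exact Finset.prod_ne_zero_iff.mpr fun b _ => pow_ne_zero _ (smul_ne_zero' b h₁)
  have hg₂ : galPow t γ₂ ≠ 0 := by
    unfold galPow
    exact Finset.prod_ne_zero_iff.mpr fun b _ => pow_ne_zero _ (smul_ne_zero' b h₂)
  refine ⟨β₁ * galPow t γ₂, β₂ * galPow t γ₁, J₁ * ∏ b, (gal p K b • M₂) ^ t b,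
    J₂ * ∏ b, (gal p K b • M₁) ^ t b, mul_ne_zero k₁ hg₂, mul_ne_zero k₂ hg₁,
    mul_ne_bot' hJ₁ (prod_gal_smul_pow_ne_bot hM₂ t), mul_ne_bot' hJ₂ (prod_gal_smul_pow_ne_bot hM₁ t),
    ?_⟩
  rw [← Ideal.span_singleton_mul_span_singleton, ← Ideal.span_singleton_mul_span_singleton]
  calc _ = (Ideal.span {β₁} * J₁ ^ q) * (Ideal.span {galPow t γ₂} *
        (∏ b, (gal p K b • M₂) ^ t b) ^ q * ∏ b, (gal p K b • I') ^ t b) := by ring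
    _ = (Ideal.span {β₁} * J₁ ^ q) * (Ideal.span {galPow t γ₁} *
        (∏ b, (gal p K b • M₁) ^ t b) ^ q * ∏ b, (gal p K b • I) ^ t b) := by rw [e2]
    _ = (Ideal.span {β₁} * J₁ ^ q * ∏ b, (gal p K b • I) ^ t b) * (Ideal.span {galPow t γ₁} *
        (∏ b, (gal p K b • M₁) ^ t b) ^ q) := by ring
    _ = _ := by rw [h]; ring

omit hl in
/-- `AnnIdeal` is multiplicative in the ideal. [folklore] -/
theorem AnnIdeal.mul {q : ℕ} {I I' : Ideal (𝓞 K)} {t : (ZMod p)ˣ → ℕ} (h : AnnIdeal q I t)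
    (h' : AnnIdeal q I' t) : AnnIdeal q (I * I') t := by
  obtain ⟨β₁, β₂, J₁, J₂, k₁, k₂, hJ₁, hJ₂, h⟩ := h
  obtain ⟨δ₁, δ₂, N₁, N₂, m₁, m₂, hN₁, hN₂, k⟩ := h'
  refine ⟨β₁ * δ₁, β₂ * δ₂, J₁ * N₁, J₂ * N₂, mul_ne_zero k₁ m₁, mul_ne_zero k₂ m₂,
    mul_ne_bot' hJ₁ hN₁, mul_ne_bot' hJ₂ hN₂, ?_⟩
  have e := congrArg₂ (· * ·) h k
  rw [← Ideal.span_singleton_mul_span_singleton, ← Ideal.span_singleton_mul_span_singleton]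
  simp only [smul_mul', mul_pow, Finset.prod_mul_distrib]
  calc _ = (Ideal.span {β₁} * J₁ ^ q * ∏ b, (gal p K b • I) ^ t b) *
        (Ideal.span {δ₁} * N₁ ^ q * ∏ b, (gal p K b • I') ^ t b) := by ring
    _ = _ := e
    _ = _ := by ring

omit hl in
/-- **`AnnIdeal` for `ι(I)`**, for symmetric `θ`. [folklore] -/
theorem AnnIdeal.iota {q : ℕ} {I : Ideal (𝓞 K)} {t : (ZMod p)ˣ → ℕ} (ht : ∀ b, t (-b) = t b)
    (h : AnnIdeal q I t) : AnnIdeal q (gal p K (-1) • I) t := by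
  obtain ⟨β₁, β₂, J₁, J₂, k₁, k₂, hJ₁, hJ₂, h⟩ := h
  refine ⟨β₁, β₂, J₁, J₂, k₁, k₂, hJ₁, hJ₂, ?_⟩
  rw [← h]
  congr 1
  -- reindex `b ↦ -b`
  refine Fintype.prod_equiv (Equiv.neg (ZMod p)ˣ) _ _ fun b => ?_
  simp only [Equiv.neg_apply, smul_smul, ← gal_mul, mul_neg, mul_one, ht]

omit hl in
/-- **`QRel` from a class-group identity `[I] = [I'] [J]^q`.** [folklore] -/
theorem QRel.of_mk0_eq {q : ℕ} {I I' J : Ideal (𝓞 K)} (hI : I ≠ ⊥) (hI' : I' ≠ ⊥) (hJ : J ≠ ⊥)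
    (h : ClassGroup.mk0 ⟨I, mem_nonZeroDivisors_of_ne_zero hI⟩ =
      ClassGroup.mk0 ⟨I', mem_nonZeroDivisors_of_ne_zero hI'⟩ *
        ClassGroup.mk0 ⟨J, mem_nonZeroDivisors_of_ne_zero hJ⟩ ^ q) :
    QRel q I I' := by
  rw [← map_pow, ← map_mul, ClassGroup.mk0_eq_mk0_iff] at h
  obtain ⟨x, y, hx, hy, hxy⟩ := h
  refine ⟨x, y, 1, J, hx, hy, ?_, hJ, ?_⟩
  · rw [Ideal.one_eq_top]; exact top_ne_bot
  · rw [one_pow, mul_one, hxy]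
    show Ideal.span {y} * (I' * J ^ q) = _
    ring

omit hl in
/-- **`QRel` from characters of `Cl_K` of exponent `q`** (duality of finite abelian groups: the
characters of `Cl_K/Cl_K^q` separate points): if `ψ[I] = ψ[I']` for every character
`ψ : Cl_K → ℂˣ` with `ψ^q = 1`, then `[I] ≡ [I']` modulo `q`-th powers. [folklore] -/
theorem QRel.of_forall_char {q : ℕ} {I I' : Ideal (𝓞 K)} (hI : I ≠ ⊥) (hI' : I' ≠ ⊥)
    (h : ∀ ψ : ClassGroup (𝓞 K) →* ℂˣ, (∀ c, ψ c ^ q = 1) →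
      ψ (ClassGroup.mk0 ⟨I, mem_nonZeroDivisors_of_ne_zero hI⟩) =
        ψ (ClassGroup.mk0 ⟨I', mem_nonZeroDivisors_of_ne_zero hI'⟩)) :
    QRel q I I' := by
  classical
  set G := ClassGroup (𝓞 K)
  set a : G := ClassGroup.mk0 ⟨I, mem_nonZeroDivisors_of_ne_zero hI⟩ with ha
  set a' : G := ClassGroup.mk0 ⟨I', mem_nonZeroDivisors_of_ne_zero hI'⟩ with ha'
  -- the subgroup of `q`-th powers and the quotient
  set P : Subgroup G := (powMonoidHom q : G →* G).range with hP
  set π : G →* G ⧸ P := QuotientGroup.mk' P with hπ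
  -- `a a'⁻¹ ∈ P`
  have hmem : a * a'⁻¹ ∈ P := by
    by_contra hnot
    have hne : π (a * a'⁻¹) ≠ 1 := by
      rwa [Ne, hπ, QuotientGroup.mk'_apply, QuotientGroup.eq_one_iff]
    haveI : NeZero ((Monoid.exponent (G ⧸ P) : ℕ) : ℂ) :=
      ⟨by exact_mod_cast Monoid.exponent_ne_zero_of_finite⟩
    obtain ⟨φ, hφ⟩ := CommGroup.exists_apply_ne_one_of_hasEnoughRootsOfUnity (G ⧸ P) ℂ hne
    apply hφ
    have hψ : ∀ c, (φ.comp π) c ^ q = 1 := fun c => by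
      rw [← map_pow, MonoidHom.comp_apply]
      have : π (c ^ q) = 1 := by
        rw [hπ, QuotientGroup.mk'_apply, QuotientGroup.eq_one_iff, hP]
        exact ⟨c, rfl⟩
      rw [this, map_one]
    have := h (φ.comp π) hψ
    rw [MonoidHom.comp_apply, MonoidHom.comp_apply] at this
    rw [map_mul, map_inv, map_mul, map_inv, this, mul_inv_cancel]
  obtain ⟨b, hb⟩ := hmem
  obtain ⟨J, hJb⟩ := ClassGroup.mk0_surjective b
  have hJ0 : (J : Ideal (𝓞 K)) ≠ ⊥ := nonZeroDivisors.coe_ne_zero J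
  refine QRel.of_mk0_eq hI hI' hJ0 ?_
  have e : (⟨(J : Ideal (𝓞 K)), mem_nonZeroDivisors_of_ne_zero hJ0⟩ :
      nonZeroDivisors (Ideal (𝓞 K))) = J := rfl
  rw [e, hJb, ← ha, ← ha']
  rw [powMonoidHom_apply] at hb
  rw [hb, mul_comm, inv_mul_cancel_right]

end Ideals

/-! ### The primitive root `s`: from `q`-th power residues to the index vector `½(δ_1 + δ_ι)` -/

/-- the target index vector `e⁺_b = (q+1)/2 · [b = ±1]` (as natural numbers). [folklore] -/
def eplus (p q : ℕ) (b : (ZMod p)ˣ) : ℕ := if b = 1 ∨ b = -1 then (q + 1) / 2 else 0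

omit hp in
/-- the cast form of `eplus` consumed by `thaine_core`. [folklore] -/
theorem natCast_eplus [Fact p.Prime] (q : ℕ) (c : (ZMod p)ˣ) :
    ((eplus p q c : ℕ) : ZMod q) = if c = 1 ∨ c = -1 then (((q + 1) / 2 : ℕ) : ZMod q) else 0 := by
  unfold eplus
  split_ifs <;> simp

include hK h𝔩m h𝔩l in
/-- **The third property of [Schoof2009, Lemma 16.2] in residue form gives the index vector
`½(δ_1 + δ_ι)` for a suitable primitive root `s` modulo `l`.** If `u₀` (prime to `l`, with
`ι(u₀) = u₀ ρ^q`) is *not* a `q`-th power modulo `𝔩` but *is* a `q`-th power modulo `σ_b(𝔩)` for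
all `b ≠ ±1`, then for some primitive root `s (mod l)`: `u₀ ≡ s^{(q+1)/2}·z^q (mod 𝔩)` and
`(mod ι𝔩)`, `u₀ ≡ z^q (mod σ_b 𝔩)` (`b ≠ ±1`), i.e. `Rep 𝔩 s q u₀ e⁺`. (The residue field
`𝓞 K/𝔩 ≅ 𝔽_l` has cyclic unit group of order `l - 1`, `q ∣ l - 1`; rescale a generator.)
[cite: Schoof2009, Lemma 16.2 (third property) and Theorem 16.3 (proof, p. 111)] -/
theorem exists_rep_eplus (hpl : p ≠ l) (hl1 : p ∣ l - 1) {q : ℕ} (hqp : q.Prime) (hq2 : q ≠ 2)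
    {u₀ : 𝓞 K} (hu0 : ∀ b, u₀ ∉ gal p K b • 𝔩)
    (hnot : ¬ ∃ z : 𝓞 K, u₀ - z ^ q ∈ 𝔩)
    (hpow : ∀ b : (ZMod p)ˣ, b ≠ 1 → b ≠ -1 → ∃ z : 𝓞 K, z ∉ gal p K b • 𝔩 ∧ u₀ - z ^ q ∈ gal p K b • 𝔩)
    (hι : ∃ ρ : 𝓞 K, gal p K (-1) • u₀ = u₀ * ρ ^ q) :
    ∃ s : ℕ, orderOf ((s : ℕ) : ZMod l) = l - 1 ∧ Rep 𝔩 s q u₀ (eplus p q) := by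
  classical
  haveI : NeZero l := ⟨hl.out.ne_zero⟩
  have hl' := hl.out
  have h𝔩1 : gal p K 1 • 𝔩 = 𝔩 := by rw [gal_one, one_smul]
  -- the residue field `F = 𝓞 K/𝔩` with `l` elements
  have hcard : Nat.card (𝓞 K ⧸ 𝔩) = l := by
    have := card_quot_smul (K := K) 𝔩 hpl hl1 1
    rwa [h𝔩1] at this
  haveI : Finite (𝓞 K ⧸ 𝔩) := Nat.finite_of_card_ne_zero (by rw [hcard]; exact hl'.ne_zero)
  letI : Fintype (𝓞 K ⧸ 𝔩) := Fintype.ofFinite _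
  letI : Field (𝓞 K ⧸ 𝔩) := Ideal.Quotient.field _
  have hcard' : Fintype.card (𝓞 K ⧸ 𝔩) = l := by rw [Fintype.card_eq_nat_card, hcard]
  let ι : ZMod l ≃+* 𝓞 K ⧸ 𝔩 := ZMod.ringEquivOfPrime _ hl' hcard'
  set N : ℕ := l - 1 with hN
  have hN0 : N ≠ 0 := by have := hl'.two_le; omega
  have hcardU : Fintype.card (𝓞 K ⧸ 𝔩)ˣ = N := by rw [Fintype.card_units, hcard']
  -- a generator `g` of the units
  obtain ⟨g, hg⟩ := IsCyclic.exists_generator (α := (𝓞 K ⧸ 𝔩)ˣ)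
  have hordg : orderOf g = N := by
    rw [orderOf_eq_card_of_forall_mem_zpowers hg, Nat.card_eq_fintype_card, hcardU]
  -- `u₀ = g^m'`
  have hu0' : Ideal.Quotient.mk 𝔩 u₀ ≠ 0 := by
    rw [Ne, Ideal.Quotient.eq_zero_iff_mem, ← h𝔩1]; exact hu0 1
  obtain ⟨m, hm⟩ := Subgroup.mem_zpowers_iff.mp (hg (Units.mk0 _ hu0'))
  set m' : ℕ := (m % N).toNat with hm'
  have hm'' : (m' : ℤ) = m % N := Int.toNat_of_nonneg (Int.emod_nonneg _ (by exact_mod_cast hN0))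
  have hgm' : g ^ m' = Units.mk0 _ hu0' := by
    rw [← hm, ← zpow_natCast, hm'', ← hordg, zpow_mod_orderOf]
  -- `q ∤ m'`
  have hqm : ¬ q ∣ m' := by
    rintro ⟨d, hd⟩
    apply hnot
    obtain ⟨z, hz⟩ := Ideal.Quotient.mk_surjective (((g ^ d : (𝓞 K ⧸ 𝔩)ˣ) : 𝓞 K ⧸ 𝔩))
    refine ⟨z, ?_⟩
    rw [← Ideal.Quotient.eq_zero_iff_mem, map_sub, map_pow, hz, ← Units.val_pow_eq_pow_val, ← pow_mul,
      mul_comm, ← hd, hgm', Units.val_mk0, sub_self]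
  -- the exponent `c ≡ 2 m' (mod q)`, `c ≡ 1 (mod N')`, coprime to `N = q^a N'`
  obtain ⟨a, N', hqN', hNfac⟩ := Nat.exists_eq_pow_mul_and_not_dvd hN0 q hqp.ne_one
  have hcopqN' : Nat.Coprime q N' := (Nat.Prime.coprime_iff_not_dvd hqp).mpr hqN'
  obtain ⟨c, hc1, hc2⟩ := Nat.chineseRemainder hcopqN' (2 * m') 1
  have hqc : ¬ q ∣ c := by
    intro hdvd
    have h1 : q ∣ 2 * m' := (Nat.ModEq.dvd_iff hc1 (dvd_refl q)).mp hdvd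
    rcases (Nat.Prime.dvd_mul hqp).mp h1 with h2 | h2
    · exact hq2 ((Nat.prime_dvd_prime_iff_eq hqp Nat.prime_two).mp h2)
    · exact hqm h2
  have hcN : Nat.Coprime c N := by
    rw [hNfac]
    refine Nat.Coprime.mul_right (Nat.Coprime.pow_right _ ((Nat.Prime.coprime_iff_not_dvd hqp).mpr hqc).symm) ?_
    rw [Nat.Coprime, hc2.gcd_eq, Nat.gcd_one_left]
  -- the primitive root `s̄ = g^c` of the residue field
  set sbar : (𝓞 K ⧸ 𝔩)ˣ := g ^ c with hsbar
  have hords : orderOf sbar = N := by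
    rw [hsbar, Nat.Coprime.orderOf_pow (by rw [hordg]; exact hcN.symm), hordg]
  -- `m' = c h + q j₀`
  set h : ℕ := (q + 1) / 2 with hh
  have h2h : 2 * h = q + 1 := by
    obtain ⟨k, hk⟩ := hqp.odd_of_ne_two hq2
    rw [hh, hk]; omega
  have hj : ∃ j₀ : ℤ, (m' : ℤ) - c * h = q * j₀ := by
    obtain ⟨d, hd⟩ := (Nat.modEq_iff_dvd.mp hc1 : (q : ℤ) ∣ (2 * m' : ℕ) - c)
    refine ⟨h * d - m', ?_⟩
    have e2 : (2 : ℤ) * h = q + 1 := by exact_mod_cast h2h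
    push_cast at hd
    linear_combination (h : ℤ) * hd - (m' : ℤ) * e2
  obtain ⟨j₀, hj₀⟩ := hj
  set w : (𝓞 K ⧸ 𝔩)ˣ := g ^ j₀ with hw
  have hdecomp : Units.mk0 _ hu0' = sbar ^ h * w ^ q := by
    rw [← hgm', hsbar, hw, ← pow_mul, ← zpow_natCast g m', ← zpow_natCast g (c * h), ← zpow_natCast (g ^ j₀) q,
      ← zpow_mul, ← zpow_add]
    congr 1
    push_cast
    linear_combination hj₀
  -- lift `s̄` to a natural number `s` and `w` to `z ∈ 𝓞 K`
  set s : ℕ := (ι.symm (sbar : 𝓞 K ⧸ 𝔩)).val with hs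
  have hιs : ι ((s : ℕ) : ZMod l) = (sbar : 𝓞 K ⧸ 𝔩) := by
    rw [hs, ZMod.natCast_zmod_val, RingEquiv.apply_symm_apply]
  have hmks : Ideal.Quotient.mk 𝔩 ((s : ℕ) : 𝓞 K) = (sbar : 𝓞 K ⧸ 𝔩) := by
    rw [map_natCast, ← map_natCast ι, hιs]
  obtain ⟨z, hz⟩ := Ideal.Quotient.mk_surjective ((w : (𝓞 K ⧸ 𝔩)ˣ) : 𝓞 K ⧸ 𝔩)
  have hz0 : z ∉ 𝔩 := by
    rw [← Ideal.Quotient.eq_zero_iff_mem, hz]; exact Units.ne_zero _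
  refine ⟨s, ?_, ?_⟩
  · -- `s` is a primitive root modulo `l`
    have : ((s : ℕ) : ZMod l) = ι.symm (sbar : 𝓞 K ⧸ 𝔩) := by rw [hs, ZMod.natCast_zmod_val]
    rw [this]
    show orderOf (ι.symm.toMulEquiv (sbar : 𝓞 K ⧸ 𝔩)) = N
    rw [MulEquiv.orderOf_eq, orderOf_units, hords]
  -- the congruence modulo `𝔩`
  have hmain : u₀ - ((s : ℕ) : 𝓞 K) ^ h * z ^ q ∈ 𝔩 := by
    rw [← Ideal.Quotient.eq_zero_iff_mem, map_sub, map_mul, map_pow, map_pow, hmks, hz,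
      ← Units.val_pow_eq_pow_val, ← Units.val_pow_eq_pow_val, ← Units.val_mul, ← hdecomp, Units.val_mk0,
      sub_self]
  intro b
  by_cases hb1 : b = 1
  · subst hb1
    refine ⟨z, by rwa [h𝔩1], ?_⟩
    rw [h𝔩1, eplus, if_pos (Or.inl rfl)]
    exact hmain
  by_cases hb2 : b = -1
  · subst hb2
    -- apply `ι` to the congruence modulo `𝔩` and divide by `ρ^q`
    obtain ⟨ρ, hρ⟩ := hι
    have hP : (gal p K (-1) • 𝔩).IsMaximal := isMaximal_smul (K := K) 𝔩 (-1)
    have h1 : gal p K (-1) • (u₀ - ((s : ℕ) : 𝓞 K) ^ h * z ^ q) ∈ gal p K (-1) • 𝔩 :=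
      (Ideal.smul_mem_pointwise_smul_iff (a := gal p K (-1))).mpr hmain
    rw [smul_sub, smul_mul', smul_pow', smul_pow', hρ] at h1
    have hsσ : gal p K (-1) • (((s : ℕ) : 𝓞 K)) = ((s : ℕ) : 𝓞 K) := by
      have := map_natCast (MulSemiringAction.toRingHom Gal(K/ℚ) (𝓞 K) (gal p K (-1))) s
      rwa [MulSemiringAction.toRingHom_apply] at this
    rw [hsσ] at h1
    have hρ0 : ρ ∉ gal p K (-1) • 𝔩 := by
      intro hmem
      have h2 : u₀ * ρ ^ q ∈ gal p K (-1) • 𝔩 :=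
        Ideal.mul_mem_left _ _ (Ideal.pow_mem_of_mem _ hmem q hqp.pos)
      rw [← hρ] at h2
      have h3 := (Ideal.smul_mem_pointwise_smul_iff (a := (gal p K (-1))⁻¹)).mpr h2
      rw [inv_smul_smul, inv_smul_smul] at h3
      exact hu0 1 (by rwa [h𝔩1])
    obtain ⟨y, i, hi, hyi⟩ := hP.exists_inv hρ0
    refine ⟨gal p K (-1) • z * y, fun hzy => ?_, ?_⟩
    · rcases hP.isPrime.mem_or_mem hzy with h3 | h3
      · apply hz0
        have := (Ideal.smul_mem_pointwise_smul_iff (a := (gal p K (-1))⁻¹)).mpr h3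
        rwa [inv_smul_smul, inv_smul_smul] at this
      · apply hP.ne_top
        rw [Ideal.eq_top_iff_one, ← hyi]
        exact Ideal.add_mem _ (Ideal.mul_mem_right _ _ h3) hi
    · rw [eplus, if_pos (Or.inr rfl)]
      have hwy : 1 - ρ * y ∈ gal p K (-1) • 𝔩 := by
        have : 1 - ρ * y = i := by rw [← hyi]; ring
        rw [this]; exact hi
      obtain ⟨d, hd⟩ := sub_dvd_pow_sub_pow (1 : 𝓞 K) (ρ * y) q
      have e : u₀ - ((s : ℕ) : 𝓞 K) ^ h * (gal p K (-1) • z * y) ^ q =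
          u₀ * (1 ^ q - (ρ * y) ^ q) + y ^ q * (u₀ * ρ ^ q - ((s : ℕ) : 𝓞 K) ^ h * (gal p K (-1) • z) ^ q) := by
        ring
      rw [e, hd]
      exact Ideal.add_mem _ (Ideal.mul_mem_left _ _ (Ideal.mul_mem_right _ _ hwy))
        (Ideal.mul_mem_left _ _ h1)
  · obtain ⟨z', hz', hx'⟩ := hpow b hb1 hb2
    refine ⟨z', hz', ?_⟩
    rw [eplus, if_neg (by tauto), pow_zero, one_mul]
    exact hx'

/-! ### Theorem 16.3 -/

omit hl in
/-- `x^{δ_1} = x`. [folklore] -/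
theorem galPow_single (x : 𝓞 K) : galPow (fun a : (ZMod p)ˣ => if a = 1 then 1 else 0) x = x := by
  classical
  unfold galPow
  rw [Finset.prod_eq_single (1 : (ZMod p)ˣ)]
  · simp only [if_true, pow_one, gal_one, one_smul]
  · intro b _ hb; simp only [if_neg hb, pow_zero]
  · intro h; exact absurd (Finset.mem_univ _) h

include hK h𝔩m h𝔩l in
omit hl in
/-- `p`-units are prime to the auxiliary primes. [folklore] -/
theorem punit_not_mem_smul [Fact l.Prime] (hpl : p ≠ l) {ζ : K} (hζ : IsPrimitiveRoot ζ p) (ε : (𝓞 K)ˣ)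
    (m : ℕ) (b : (ZMod p)ˣ) : (ε : 𝓞 K) * (hζ.toInteger - 1) ^ m ∉ gal p K b • 𝔩 := by
  intro h
  have hP := (isMaximal_smul (K := K) 𝔩 b).isPrime
  rcases hP.mem_or_mem h with h1 | h1
  · exact not_mem_smul_of_isUnit (K := K) 𝔩 ε.isUnit b h1
  · exact toInteger_sub_one_not_mem_smul (K := K) 𝔩 hpl hζ b (hP.mem_of_pow_mem _ h1)

include hK in
/-- **[Schoof2009, Theorem 16.3] (F. Thaine, 1988), class-group-free form, from the auxiliary
primes of [Schoof2009, Lemma 16.2].** Let `p` be an odd prime, `K = ℚ(ζ_p)` with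
`G = Gal(K/ℚ) = {σ_b}`, `ι = σ_{-1}`, `π = ζ_p - 1`, and `q` an odd prime. Let
`θ = ∑_b t_b σ_b ∈ ℕ[G]` be symmetric (`t_{-b} = t_b`, i.e. `θ ∈ ℕ[G⁺]`) and suppose that **`θ`
annihilates the `p`-unit `u₀` modulo cyclotomic units and `q`-th powers**:
`u₀^θ · (ε_w π^{m_w})^q = γ · (ε_v π^{m_v})^q` with `γ = (-1)^{e₀} ζ^{e₁} ∏_a (ζ^a - 1)^{n_a}`
(in the application `u₀` generates `E/E^q` over `𝔽_q[G⁺]`, [Schoof2009, Cor. 13.7], so this is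
"`θ` annihilates `E/C E^q`"), where `ι(u₀) = u₀ ρ^q` ([Schoof2009, Lemma 13.6]). Assume the
conclusion of [Schoof2009, Lemma 16.2] for `u₀` (`hAux`): for every non-zero ideal `𝔠` of `𝓞 K`
there are a prime `l ≡ 1 (mod p)`, `l ≡ 1 (mod q)`, and a prime `𝔩 ∣ l` of `K` whose class is
that of `𝔠` modulo principal ideals and `q`-th powers (`QRel`), such that `u₀` is not a `q`-th
power modulo `𝔩` but is a `q`-th power modulo `σ_b(𝔩)` for all `b ≠ ±1`. **Then `θ` annihilates
the class of `𝔠 · ι(𝔠)` in `Cl_K/Cl_K^q` for every `𝔠`**: `∏_b σ_b(𝔠 ι𝔠)^{t_b}` is a principal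
ideal times a `q`-th power (`AnnIdeal`). (Every `ι`-invariant class `c` modulo `q`-th powers is
`[𝔠 · ι𝔠]` with `𝔠 ∈ c^{(q+1)/2}`, so *`θ` annihilates `(Cl_K/Cl_K^q)⁺ ⊇ Cl⁺/Cl⁺^q`*.)
[cite: Schoof2009, Theorem 16.3 (proof, pp. 109–111)] [cite: Washington1997, Thm. 15.2] -/
theorem thaine (hp2 : p ≠ 2) {q : ℕ} (hqp : q.Prime) (hq2 : q ≠ 2) {ζ : K} (hζ : IsPrimitiveRoot ζ p)
    {t : (ZMod p)ˣ → ℕ} (ht : ∀ b, t (-b) = t b)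
    {u₀ : 𝓞 K} {εu : (𝓞 K)ˣ} {mu : ℕ} (hu : u₀ = εu * (hζ.toInteger - 1) ^ mu)
    (hι : ∃ ρ : 𝓞 K, gal p K (-1) • u₀ = u₀ * ρ ^ q)
    {εv εw : (𝓞 K)ˣ} {mv mw e₀ e₁ : ℕ} {n : (ZMod p)ˣ → ℕ}
    (H : galPow t u₀ * ((εw : 𝓞 K) * (hζ.toInteger - 1) ^ mw) ^ q =
      cycElt hζ e₀ e₁ n * ((εv : 𝓞 K) * (hζ.toInteger - 1) ^ mv) ^ q)
    (hAux : ∀ 𝔠 : Ideal (𝓞 K), 𝔠 ≠ ⊥ →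
      ∃ (l : ℕ) (_ : Fact l.Prime) (𝔩 : Ideal (𝓞 K)) (_ : 𝔩.IsMaximal)
        (_ : 𝔩.LiesOver (Ideal.span {(l : ℤ)})),
        p ≠ l ∧ p ∣ l - 1 ∧ q ∣ l - 1 ∧ QRel q 𝔩 𝔠 ∧
        (¬ ∃ z : 𝓞 K, u₀ - z ^ q ∈ 𝔩) ∧
        (∀ b : (ZMod p)ˣ, b ≠ 1 → b ≠ -1 →
          ∃ z : 𝓞 K, z ∉ gal p K b • 𝔩 ∧ u₀ - z ^ q ∈ gal p K b • 𝔩)) :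
    ∀ 𝔠 : Ideal (𝓞 K), 𝔠 ≠ ⊥ → AnnIdeal q (𝔠 * gal p K (-1) • 𝔠) t := by
  intro 𝔠 h𝔠
  obtain ⟨l, hlF, 𝔩, h𝔩m, h𝔩l, hpl, hl1, hlq, hrel, hnot, hpow⟩ := hAux 𝔠 h𝔠
  haveI := hlF
  haveI := h𝔩m
  haveI := h𝔩l
  haveI : NeZero q := ⟨hqp.ne_zero⟩
  have hq : Odd q := hqp.odd_of_ne_two hq2
  -- `u₀, v, w` are prime to `l`
  have hu0 : ∀ b, u₀ ∉ gal p K b • 𝔩 := fun b => by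
    rw [hu]; exact punit_not_mem_smul (K := K) 𝔩 hpl hζ εu mu b
  have hv : ∀ b, (εv : 𝓞 K) * (hζ.toInteger - 1) ^ mv ∉ gal p K b • 𝔩 := fun b =>
    punit_not_mem_smul (K := K) 𝔩 hpl hζ εv mv b
  have hw : ∀ b, (εw : 𝓞 K) * (hζ.toInteger - 1) ^ mw ∉ gal p K b • 𝔩 := fun b =>
    punit_not_mem_smul (K := K) 𝔩 hpl hζ εw mw b
  -- the primitive root `s` and the index vector `e⁺` of `u₀ = u₀^{δ_1}`
  obtain ⟨s, hs, hrep⟩ := exists_rep_eplus (K := K) 𝔩 hpl hl1 hqp hq2 hu0 hnot hpow hι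
  have hy : Rep 𝔩 s q (galPow (fun a : (ZMod p)ˣ => if a = 1 then 1 else 0) u₀) (eplus p q) := by
    rw [galPow_single]; exact hrep
  -- Theorem 16.3 for `𝔩`, then for `ι𝔩`, `𝔩 ι𝔩` and finally `𝔠 ι𝔠`
  have h1 : Ann 𝔩 q (fun b : (ZMod p)ˣ => (t b : ZMod q)) :=
    thaine_core (K := K) 𝔩 hp2 hq hpl hl1 hlq hs hζ ht hv hw H hy (natCast_eplus q)
  have h2 : AnnIdeal q 𝔩 t :=
    Ann.to_nat (Ring.ne_bot_of_isMaximal_of_not_isField h𝔩m (RingOfIntegers.not_isField K)) h1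
  have h3 : AnnIdeal q (𝔩 * gal p K (-1) • 𝔩) t := h2.mul (h2.iota ht)
  exact h3.congr (hrel.mul (hrel.smul (-1)))

end Catalan.Thaine

end Literature.NumberTheory.DiophantineGeometry
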